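import Mathlib
import HarnessLib
import HarnessLib.Audit
import Summits.MatrixMultiplication.Statement
import Literature.Combinatorics.Additive.TripleProductProperty
import Literature.Computability.AlgebraicComplexity.GroupTheoreticMatMul
import Literature.Computability.AlgebraicComplexity.GroupTheoreticMatMulProofs
import Literature.Computability.AlgebraicComplexity.FlatteningBound
import HarnessLib.Audit.Status.Attr

/-!
Route: AutomaticSTPPDesigns

DORMANT since 2026-08-29T19:37:13Z (census g0: costume|duplicate of route-MatrixMultiplication-EisensteinValCertificates; reader census-reader-47-g0) — unstaffed, not closed; items shared with open routes are served there. `ledger route dormant <id> --off` reactivates.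

# Route AutomaticSTPPDesigns — regular (p-automatic) STPP design families in Z_(p^k), decidable at
all scales, certify omega through CKSU 5.5

It suffices to show X_aut (card automatic-stpp-designs-buchi, constructive horn): for some base p >=
2 and every eps > 0
there are three REGULAR languages L_A, L_B, L_C over the alphabet iota x Fin p (iota a finite index
alphabet; a word of
length k read on the pair track (w, a) says "the element of Z_(p^k) with base-p digits a, least
significant first, lies in the
block A_w"), such that (i) at EVERY scale k the family (A_w, B_w, C_w) indexed by w in iota^k is an
STPP construction in
Z_(p^k) (CKSU Def 5.1, the tree's AddSimultaneousTPP), and (ii) at infinitely many scales its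
packing sum beats the host:
p^k < Sum_w (|A_w||B_w||C_w|)^((2+eps)/3). By CKSU Thm 5.5 (abelian, PROVED in tree) each such scale
forces
omega < 2 + eps, so X_aut -> omega(C) = 2. Validity (i) is decidable uniformly in k (support
SmallScalesSuffice), so a
witness of X_aut at any fixed eps is a finite object checked by one terminating computation.
Lean: `∃ p : ℕ, 2 ≤ p ∧ ∀ ε : ℝ, 0 < ε → ∃ (ι : Type) (_ : Fintype ι) (LA LB LC : Language (ι × Fin
p)), LA.IsRegular ∧ LB.IsRegular ∧ LC.IsRegular ∧ (let blk := fun (k : ℕ) (L : Language (ι × Fin p))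
(w : Fin k → ι) => ((Finset.univ : Finset (Fin k → Fin p)).filter (fun a => List.ofFn (fun j : Fin k
=> (w j, a j)) ∈ L)).image (fun a : Fin k → Fin p => ((∑ j : Fin k, (a j : ℕ) * p ^ (j : ℕ) : ℕ) :
ZMod (p ^ k))); (∀ k : ℕ, Literature.Combinatorics.Additive.AddSimultaneousTPP (blk k LA) (blk k LB)
(blk k LC)) ∧ ∀ k₀ : ℕ, ∃ k ≥ k₀, (p : ℝ) ^ k < ∑ w : Fin k → ι, (((blk k LA w).card * (blk k LB
w).card * (blk k LC w).card : ℕ) : ℝ) ^ ((2 + ε) / 3))`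

## Assembly
Pure logic plus two tree theorems: if omega(C) > 2 put eps := omega - 2 in X_aut, take a scale k
where the packing sum at
exponent omega/3 exceeds p^k, reindex the level-k family (index type Fin k -> iota) along an
equivalence with Fin N
(AddSimultaneousTPP.comp, isSTPP_iff_addSimultaneousTPP) and apply
CohnKleinbergSzegedyUmans2005_5_5_abelian_holds in
Z_(p^k) (a Fintype since p >= 2): contradiction; omega >= 2 is Literature.CplxAlg.two_le_omega.
Equivalently X_aut -> CThesis
(stmt-0593) -> MatrixMultiplication.GroupTheoreticSTPP.matrixMultiplication_of_cksu_of_thesis.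

Rationale: WHY THIS LINE. Route GroupTheoreticSTPP (CThesis, stmt-0593) lives or dies in abelian groups of
UNBOUNDED exponent (BCCGNSU2017 Thm B, proved in
tree, kills bounded exponent; cyclic groups have full slice rank, BlasiakChurchCohnGrochowUmans2017
Thm B.8), where print has
neither a packing-bound construction nor an obstruction (BlasiakCohnGrochowPrattUmans2023 p.3) and
where a candidate could not
even be VERIFIED: a family, one design per k, is an infinite object. The line imports automata
theory / Buechi arithmetic
(Bruyere-Hansel-Michaux-Villemaire 1994, doi:10.36045/bbms/1103408547; Walnut, arXiv:1603.06017;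
Shallit 2022,
doi:10.1017/9781108775267; additive combinatorics of automatic sets, BellHareShallit2018,
doi:10.1090/bproc/37): designs read
by synchronous finite automata on base-p digits are exactly the families whose STPP validity for ALL
k is one decidable
sentence (carries are synchronous-automatic), so search becomes meaningful and every hit is a
theorem at all scales; their
packing sums are matrix-cocycle pressures (regular-language growth, SzilardYuZhangShallit1992,
doi:10.1007/3-540-55808-x_48).
New relative to the card (planner's analysis): (a) BlockTensorTransfer — every finite STPP design in
Z_N block-tensors carry-free
into an all-scale regular family once p^K >= 3N-2 — so tameness costs NOTHING at thesis level, X_aut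
is a normal form of the
cyclic-tower packing thesis, and the card's uniform 'regular-design barrier c(p)' would be a full
cyclic obstruction (route C's
CAbelianObstructionNeg, not filed here); (b) cyclic hosts include CRT products of coprime moduli, so
CKSU Prop 5.2 / Thm 6.6
with distinct prime moduli already give nontrivial regular towers (support
NontrivialAllScalesFamily), but only tau ~ 0.94 and
drifting to 1; (c) the honest tameness statements are per-automaton: RegularTowerGap (one regular
tower never witnesses every
eps: infimum-not-minimum along a tower) and SingleAutomatonRigidity (never within a constant of the
packing bound), each of whose
failure would give omega = 2 outright. Negatives index: empty at filing.

RANKED CRUXES. #0 AutomaticPackingThesis (target) — X_aut as in the Thesis: some base p >= 2 such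
that for every eps > 0 a regular all-scale STPP family in the Z_(p^k) tower beats p^k at exponent
(2+eps)/3 at infinitely many scales. (why it might fail: Equivalent in strength to CKSU-type packing
constructions in cyclic p-towers (BlockTensorTransfer): open since 2005, no family in any group is
known to meet the packing bound (arXiv:2204.03826 p.3); Pratt2024 Conj 4.1 would bar Z_n hosts.)
[CohnKleinbergSzegedyUmans2005, BlasiakChurchCohnGrochowNaslundSawinUmans2017,
BlasiakCohnGrochowPrattUmans2023, Pratt2024, doi:10.36045/bbms/1103408547]
#2 AutomaticDesignBelowFourFifths (crux) — (card T2) there exist a base p >= 2 and three regular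
languages whose all-scale family is STPP in every Z_(p^k) and satisfies p^k < Sum_w
(|A_w||B_w||C_w|)^(4/5) at infinitely many scales k; with CKSU 5.5 this certifies omega <= 2.4 from
a cyclic tower by a finitely described, machine-verified design, matching the best group-theoretic
bounds (CKSU 2.41, in bounded exponent). Necessary for the target (eps = 2/5; proved in
Sketch.lean). [deps: BlockTensorTransfer, SmallScalesSuffice] [difficulty: XL] (why it might fail:
Regular all-scale families contain the block-tensors of every finite cyclic design, yet designs in
print re-hosted cyclically (CRT, distinct primes) certify only tau ~ 0.94 (CKSU Prop 5.2: 0.95; Thm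
6.6 with an 8!-local USP of width 40: 0.94), drifting to 1; tau = 0.8 needs carries to do new work.)
[CohnKleinbergSzegedyUmans2005, BlasiakChurchCohnGrochowNaslundSawinUmans2017,
BlasiakCohnGrochowPrattUmans2023, arXiv:1603.06017, doi:10.1017/9781108775267]
#3 RegularTowerGap (crux) — (card T3, corrected to the per-automaton form; infimum-not-minimum along
one regular tower) for every base p >= 2 and every triple of regular languages whose family is STPP
at all scales there is eps > 0 such that eventually Sum_w (|A_w||B_w||C_w|)^((2+eps)/3) <= p^k: no
single automaton witnesses X_aut for every eps, so omega = 2 by this route needs a SEQUENCE of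
automata. Its negation implies AutomaticPackingThesis, hence MatrixMultiplication, directly.
[difficulty: L] (why it might fail: May be false (one regular tower witnessing every eps gives omega
= 2 outright); it holds for free if omega > 2 (CKSU 5.5, eps = omega - 2), so an unconditional proof
is a genuine tameness theorem about matrix-cocycle pressures at P(2/3) = log p, with no tool in
print.) [CohnKleinbergSzegedyUmans2005, BlasiakChurchCohnGrochowNaslundSawinUmans2017,
doi:10.1007/3-540-55808-x_48, doi:10.36045/bbms/1103408547,
lean:Literature.Barriers.MatrixMultiplication.InfimumNotMinimumBarrier]
#4 SingleAutomatonRigidity (crux) — (packing-bound form) for every base p >= 2 and every triple of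
regular languages whose family is STPP at all scales, the packing functional at the critical
exponent is o(p^k): for every c > 0, eventually Sum_w (|A_w||B_w||C_w|)^(2/3) <= c p^k. By Hoelder
over the three packing bounds the sum is always <= p^k, so this says no regular tower stays within a
constant of the packing bound (BCCGNSU Def 2.3 / Lemma 2.4) along its scales. Its negation gives
MatrixMultiplication (bounded blocks: triangle removal, in Mathlib; growing blocks: CKSU 5.5).
[deps: RegularTowerGap] [difficulty: L] (why it might fail: Weaker cousin of RegularTowerGap
(implied by it plus triangle removal); may fail only via a tower meeting the packing bound within a
constant (then omega = 2); unconditionally, removal lemmas cover bounded blocks and nothing controls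
growing blocks in Z_(p^k) (slice rank powerless, Thm B.8).)
[BlasiakChurchCohnGrochowNaslundSawinUmans2017, BlasiakChurchCohnGrochowUmans2017,
CohnKleinbergSzegedyUmans2005, doi:10.1007/3-540-55808-x_48,
lean:Literature.Combinatorics.Additive.AddSimultaneousTPP.sum_card_mul_card_le]
#9 SmallScalesSuffice (support) — (card (D), the verification engine as a theorem) for DFAs M_A,
M_B, M_C on state sets sA, sB, sC reading iota x Fin p (p >= 2): if the induced family is STPP in
Z_(p^k) for every k <= 14 (|sA||sB||sC|)^2 then it is STPP at every scale. Proof route: violations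
of either clause of AddSimultaneousTPP form a regular language (six membership runs, a carry in
[-3,3], one inequality flag: 14 (|sA||sB||sC|)^2 live states plus a sink), and Mathlib's
DFA.pumping_lemma shortens any longer violation. [difficulty: provable-now]
[doi:10.36045/bbms/1103408547, doi:10.1017/9781108775267, lean:DFA.pumping_lemma]
#9 BlockTensorTransfer (support) — (planner's calibration lemma) every finite STPP design
(A_i,B_i,C_i) in Z_N (IsSTPP, N >= 1) with Sum_i (|A_i||B_i||C_i|)^tau > 3pN yields, for that base p
>= 2, three regular languages whose all-scale family is STPP in every Z_(p^k) and beats p^k at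
exponent tau at infinitely many scales: write representatives in [0,N) in base p inside blocks of K
digits with p^K >= 3N-2 (so p^K < 3pN) and concatenate m blocks (index words i_1 #^(K-1) i_2 ...;
other lengths give empty blocks); no carry crosses a block since |s'-s+t'-t+u'-u| <= 3(N-1) < p^K,
so level Km is the m-fold product design (CKSU Lemma 5.4, AddSimultaneousTPP.prod) with packing sum
(Sum_i x_i^tau)^m > p^(Km). [difficulty: provable-now] [CohnKleinbergSzegedyUmans2005,
lean:Literature.Combinatorics.Additive.AddSimultaneousTPP.prod,
lean:Literature.Computability.AlgebraicComplexity.isSTPP_iff_addSimultaneousTPP]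
#9 NontrivialAllScalesFamily (support) — (first rung, provable now) there exist a base p >= 2 and
three regular languages whose all-scale family is STPP in every Z_(p^k) with solution mass exceeding
the host, p^k < Sum_w |A_w||B_w||C_w|, at infinitely many scales (tau = 1: a machine-checkable
regular tower certifying some omega < 3). Recipe: CKSU Prop 5.2 in Z_(n1) x Z_(n2) x Z_(n3) = Z_(n1
n2 n3) (CRT, pairwise coprime n_i >= 100) has mass 2 (n1-1)(n2-1)(n3-1); its cube over 9 pairwise
coprime moduli (CKSU Lemma 5.4) is a design in a cyclic Z_N with mass > 7N > 3pN for p = 2; apply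
BlockTensorTransfer with tau = 1. [difficulty: provable-now] [CohnKleinbergSzegedyUmans2005,
lean:Literature.Combinatorics.Additive.AddSimultaneousTPP.prod]

TWO-LAYER PLAN. Foreseen glued splits (none filed now): RegularTowerGap <= SingleAutomatonRigidity
-> PressureDichotomy (for an all-scale regular
STPP family either Sum_w x_w^(2/3) >= c p^k infinitely often or some eps-gap holds eventually:
quasi-multiplicativity of the
counting cocycle) -> RegularTowerGap; SingleAutomatonRigidity <= BoundedBlockRemoval (mass on blocks
of bounded size is o(p^k),
triangle removal / IsTricoloredSumFree) -> GrowingBlockGap -> SingleAutomatonRigidity;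
AutomaticDesignBelowFourFifths <=
FiniteCyclicFourFifthsDesign (a finite STPP design in some Z_N with Sum x_i^(4/5) > 6N) ->
BlockTensorTransfer -> crux, or a
carry-using automaton found by search, certified through SmallScalesSuffice plus an explicit growth
lower bound.

KILL CRITERIA. Target => AutomaticDesignBelowFourFifths (eps = 2/5), so a refutation of
AutomaticDesignBelowFourFifths closes the route (close
--reason refuted:AutomaticDesignBelowFourFifths). Route C's CAbelianObstructionNeg (stmt-0596)
proved, or any uniform bound 'for
every p there is eps > 0 such that every regular all-scale family eventually has Sum_w
x_w^((2+eps)/3) <= p^k' (= not X_aut),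
closes it as well; a proof of Pratt2024 Conj 4.1 for Z_(p^k) hosts forces a pivot to hosts (Z/p^k)^m
with automatic index sets or
closure. RegularTowerGap or SingleAutomatonRigidity REFUTED is not a kill but a win (omega = 2
follows); both PROVED sharpens the
line (witnesses need a growing sequence of automata) without closing it. CThesis (0593) proved
elsewhere moots the route.

NOT DECOMPOSED YET. The pressure formalism (P) of the card (existence of lim k^-1 log Sum_w x_w^tau
as a matrix-cocycle pressure, log-convexity,
Bowen's equation rho(tau*) = p) is deliberately not an item: no crux needs more than raw
inequalities at infinitely many
scales; it reappears only as the glue PressureDichotomy above. The two-families (CKSU Conj 4.7 /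
CPackingConstruction 0595)
automatic variant, state-count-dependent gaps, multi-base (Cobham) rigidity, non-prime bases and
mixed hosts (Z/p^k)^m with
automatic index sets are layer-2 material after a crux closes. No third layer will be filed; helper
lemmas (digit-value
bijection, carry automaton, block reindexing) ride with --supports.

CHEAPEST FALSIFIER. Two cheap computations (not run: plancard seat; lit/kit services saturated this
session). (1) Finite-design lookup/optimisation:
maximise over pairwise-coprime moduli sets and (local) strong USP sizes in print the exponent tau
certified by CRT re-hosting of
CKSU Thm 6.6 / Prop 5.2 designs; planner's estimate gives tau ~ 0.94 (numbers below) — an instance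
with Sum x_i^(4/5) > 6N would
settle crux 2 at once via BlockTensorTransfer, its absence calibrates how much carries must
contribute. (2) Kit search: synchronous
DFAs with <= 3 states over p = 2, |iota| <= 2, one transition structure with three accept sets
(~2.7e8 candidates); keep those STPP
for all k (SmallScalesSuffice: product-automaton emptiness, 14*27^2 = 10206 live states); tabulate
Sum_w x_w and Sum_w x_w^(4/5)
against 2^k for k <= 20 — the first data on whether carries ever raise packing above the carry-free
block-tensor families. For the
negative cruxes the cheapest rung is BoundedBlockRemoval via Mathlib's triangle removal.

NUMBERS. tau = omega/3 thresholds: packing bound tau = 2/3 <-> omega = 2; crux 2 tau = 4/5 <-> omega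
<= 2.4; support tau = 1 <-> omega < 3.
In print: omega < 2.371339 (AlmanEtAl2024, arXiv:2404.16349), tau = 0.7905; CW1990 2.376 (0.792);
group-theoretic CKSU2005 2.41
(0.803) and 2.48 (0.827) — all in bounded-exponent hosts, barred from omega = 2 by Thm B. Cyclic
re-hosting of finite designs
(planner's computation, this session): CKSU Prop 5.2 in Z_(n1 n2 n3), coprime n_i ~ 100: 2 X^tau = N
gives tau = 0.952; Thm 6.6
with the 8!-element local strong USP of width 40 (u!-conversion of a size-8, width-5 strong USP)
over the first 40 odd primes:
tau = 0.943; with k distinct primes the certified tau -> 1 as k -> infinity (Sum log p_j ~ k log k).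
Guard of BlockTensorTransfer:
p^K in [3N-2, 3pN). SmallScalesSuffice bound: k <= 14 (|sA||sB||sC|)^2. Hoelder ceiling: Sum_w
x_w^(2/3) <= p^k for every STPP
family. Items at open: 8 (target, assembly, 3 cruxes, 3 support).

DEFINITION REQUESTS. None needed to state the items: blocks are inlined as `blk k L w` (image of the
accepted digit words under the base-p value
map into ZMod (p^k)) over Mathlib's `Language`, `Language.IsRegular`, `DFA` and the tree's
`AddSimultaneousTPP` / `IsSTPP`. A
convenience definition `automaticBlock p k L w`, defeq to the inlined `blk`, with card/membership
simp-lemmas in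
Summits/MatrixMultiplication/MatrixMultiplication/Theorems is requested after open (workitem --kind
definition) so that all
items share one API.

Novelty: Searches (2026-08-15): card audit (refuter-novelty-audit-10-0: zbMATH 'automatic sequences sum-free
decidable Walnut additive' 0,
'k-regular sequences growth joint spectral radius' 2, TPP queries: no automata in the
CU/BCCGU/Hedtke line); this seat: `lit
frontier MatrixMultiplication --since 2022` (30 rows, none on automata or cyclic designs), `lit
bridges MatrixMultiplication
--cross any` (30 rows, none), `lit search --source crossref` 'characterizing regular languages
polynomial densities' (found
doi:10.1007/3-540-55808-x_48, doi:10.1142/s0129054110007441), 'When is an automatic set an additive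
basis' (doi:10.1090/bproc/37),
`--source zbmath` 'automatic sequences additive combinatorics decidable Presburger' (1:
doi:10.1017/9781108775267), 'triple
product property cyclic groups matrix multiplication' (0 relevant); `lit read arxiv:math/0511460`
sec. 5-6 (Def 5.1, Prop 5.2,
Lemma 5.4, Thm 5.5, Thm 6.6 checked on the materialised pages); local searchd, galaxy and the
arXiv/S2/OpenAlex APIs were
unavailable (reset / 429) this session; 140 idea cards and 11 route files of the sub-problem scanned
by title (digit-restricted
designs only in unipotent-congruence-towers / padic-congruence-tower-tpp, non-abelian, no automata).
Nearest prior art found: CohnKleinbergSzegedyUmans2005 (arXiv:math/0511460, Def 5.1/Thm 5.5/Thm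
6.6/Conj 4.7) with
BlasiakChurchCohnGrochowNaslundSawinUmans2017 (arXiv:1605.06702, Thm B, unbounded-exponent loophole)
on the design side;
Bruyere-Hansel-Michaux-Vill  [refs: 10.1007/3-540-55808-x_48, 10.1142/s0129054110007441, 10.1090/bproc/37, 10.1017/9781108775267, 10.36045/bbms/1103408547, math/0511460, 1605.06702, 1603.06017, doi:10.1007/3-540-55808-x_48, doi:10.1142/s0129054110007441, doi:10.1090/bproc/37, doi:10.1017/9781108775267, arxiv:math/0511460, doi:10.36045/bbms/1103408547, CohnKleinbergSzegedyUmans2005, BlasiakChurchCohnGrochowNaslundSawinUmans2017]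

Barriers (technique_class: group-theoretic-approach, STPP, automatic-designs): - technique_class: group-theoretic-approach, STPP, automatic-designs
- Literature.Barriers.MatrixMultiplication.TricoloredSumFreeBarrier: void for the hosts used —
Z_(p^k) with k -> infinity has unbounded exponent and full slice rank (BCCGU Thm B.8); Thm B (proved
in tree) re-enters only through fixed-length carry-free windows, which BlockTensorTransfer shows are
Z_(p^K)-designs (exponent p^K growing with the automaton), not (Z_p)^K-designs; a quantitative
re-entry for ONE automaton is exactly what RegularTowerGap / SingleAutomatonRigidity would
formalise.
- Literature.Barriers.MatrixMultiplication.NilpotentGroupBarrier: its abelian instance is (Z/p^k)^m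
with k fixed (bounded exponent); here m = 1, k -> infinity; outside the class by hypothesis.
- Literature.Barriers.MatrixMultiplication.IrreversibilityBarrier: the host tensor <Z_(p^k)> is the
unit tensor <p^k> after DFT (reversible); the monomial version (CVZ Thm 13/14, sec. 4.3) degenerates
to the tricolored-sum-free bound, void in cyclic towers by Behrend / Thm B.8 — the same evasion by
hypothesis as route C.
- Literature.Barriers.MatrixMultiplication.InfimumNotMinimumBarrier: applies at every single scale k
(a fixed STPP design is a fixed direct sum inside C[Z_(p^k)], so CW82 strict ASI gives Sum
x_w^(omega/3) < p^k strictly): evaded as CW families evade it, by k -> infinity along the tower;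
RegularTowerGap asks whether the barrier persists along one REGULAR tower (conjecturally yes), so
omega = 2 would need a sequence of

History (route lifecycle, newest last):
- 2026-08-16T04:10:30Z · AUTO-CRUX (backfill): AutomaticPackingThesis — hypotheses of the deciding theorem that nothing in the route derives are cruxes (operator:999:1085951)
- 2026-08-26T12:40:40Z · DORMANT — reconciler: no traction for 7.8 d (last activity item-evidence-added at 2026-08-18T16:38:20Z); parked, not closed — `ledger route dormant route-MatrixMultiplica (operator:999:2561087)
- 2026-08-27T22:30:47Z · REACTIVATED — reconciler: reactivated — activity item-evidence-added at 2026-08-27T21:10:43Z after parking at 2026-08-26T12:40:40Z (operator:999:2325293)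
- 2026-08-29T19:37:13Z · DORMANT — census g0: costume|duplicate of route-MatrixMultiplication-EisensteinValCertificates; reader census-reader-47-g0 (operator:999:1435841)

sub-problem: MatrixMultiplication · status: dormant · opened planner-plancard-MatrixMultiplication-MatrixM-a006c2b9-0 2026-08-15T12:08:30Z · rev 1 · ledger route-MatrixMultiplication-AutomaticSTPPDesigns
GENERATED by the gate from the ledger (D-0016/17). Provers cite these decls: `theorem foo : Summit.MatrixMultiplication.MatrixMultiplication.Theses.AutomaticSTPPDesigns.<Decl> := …` in Summits/MatrixMultiplication/MatrixMultiplication/Theorems/<Name>.lean.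
-/

namespace Summit.MatrixMultiplication.MatrixMultiplication.Theses.AutomaticSTPPDesigns

open scoped BigOperators Topology Manifold Classical MeasureTheory ProbabilityTheory Matrix InnerProductSpace ComplexConjugate ContinuousMap
open Filter Set Function TopologicalSpace MeasureTheory

attribute [summit_statement] _root_.MatrixMultiplication

/-- item stmt-MatrixMultiplication-7356 · crux (kind.auto-crux: conjecture-grade) · rank 0 · open · by planner
why it might fail: Equivalent in strength to CKSU-type packing constructions in cyclic p-towers (BlockTensorTransfer): open since 2005, no family in any group is known to meet the packing bound (arXiv:2204.03826 p.3); Pratt2024 Conj 4.1 would bar Z_n hosts.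
sources: CohnKleinbergSzegedyUmans2005, BlasiakChurchCohnGrochowNaslundSawinUmans2017, BlasiakCohnGrochowPrattUmans2023, Pratt2024, doi:10.36045/bbms/1103408547
[target] X_aut as in the Thesis: some base p >= 2 such that for every eps > 0 a regular all-scale
STPP family in the Z_(p^k) tower beats p^k at exponent (2+eps)/3 at infinitely many scales. -/
@[route_item "route-MatrixMultiplication-AutomaticSTPPDesigns", crux]
def AutomaticPackingThesis : Prop :=
  ∃ p : ℕ, 2 ≤ p ∧ ∀ ε : ℝ, 0 < ε → ∃ (ι : Type) (_ : Fintype ι) (LA LB LC : Language (ι × Fin p)), LA.IsRegular ∧ LB.IsRegular ∧ LC.IsRegular ∧ (let blk := fun (k : ℕ) (L : Language (ι × Fin p)) (w : Fin k → ι) => ((Finset.univ : Finset (Fin k → Fin p)).filter (fun a => List.ofFn (fun j : Fin k => (w j, a j)) ∈ L)).image (fun a : Fin k → Fin p => ((∑ j : Fin k, (a j : ℕ) * p ^ (j : ℕ) : ℕ) : ZMod (p ^ k))); (∀ k : ℕ, Literature.Combinatorics.Additive.AddSimultaneousTPP (blk k LA) (blk k LB) (blk k LC)) ∧ ∀ k₀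 : ℕ, ∃ k ≥ k₀, (p : ℝ) ^ k < ∑ w : Fin k → ι, (((blk k LA w).card * (blk k LB w).card * (blk k LC w).card : ℕ) : ℝ) ^ ((2 + ε) / 3))

/-- item stmt-MatrixMultiplication-7357 · crux · rank 2 · closed · proved by Summit.MatrixMultiplication.MatrixMultiplication.Theorems.AutomaticDesignBelowFourFifths_proof @ 08d8e8ffda1e (prover) · by planner
why it might fail: Regular all-scale families contain the block-tensors of every finite cyclic design, yet designs in print re-hosted cyclically (CRT, distinct primes) certify only tau ~ 0.94 (CKSU Prop 5.2: 0.95; Thm 6.6 with an 8!-local USP of width 40: 0.94), drifting to 1; tau = 0.8 needs carries to do new work.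
sources: CohnKleinbergSzegedyUmans2005, BlasiakChurchCohnGrochowNaslundSawinUmans2017, BlasiakCohnGrochowPrattUmans2023, arXiv:1603.06017, doi:10.1017/9781108775267
[crux] (card T2) there exist a base p >= 2 and three regular languages whose all-scale family is
STPP in every Z_(p^k) and satisfies p^k < Sum_w (|A_w||B_w||C_w|)^(4/5) at infinitely many scales k;
with CKSU 5.5 this certifies omega <= 2.4 from a cyclic tower by a finitely described,
machine-verified design, matching the best group-theoretic bounds (CKSU 2.41, in bounded exponent).
Necessary for the target (eps = 2/5; proved in Sketch.lean). [deps: BlockTensorTransfer,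
SmallScalesSuffice] [difficulty: XL] -/
@[route_item "route-MatrixMultiplication-AutomaticSTPPDesigns"]
def AutomaticDesignBelowFourFifths : Prop :=
  ∃ (p : ℕ) (ι : Type) (_ : Fintype ι) (LA LB LC : Language (ι × Fin p)), 2 ≤ p ∧ LA.IsRegular ∧ LB.IsRegular ∧ LC.IsRegular ∧ (let blk := fun (k : ℕ) (L : Language (ι × Fin p)) (w : Fin k → ι) => ((Finset.univ : Finset (Fin k → Fin p)).filter (fun a => List.ofFn (fun j : Fin k => (w j, a j)) ∈ L)).image (fun a : Fin k → Fin p => ((∑ j : Fin k, (a j : ℕ) * p ^ (j : ℕ) : ℕ) : ZMod (p ^ k))); (∀ k : ℕ, Literature.Combinatorics.Additive.AddSimultaneousTPP (blk k LA) (blk k LB) (blk k LC)) ∧ ∀ k₀ : ℕ, ∃ k ≥ k₀, (p : ℝ) ^ k < ∑ w : Fin k → ι, (((blk k LA w).card * (blk k LB w).card * (blk k LC w).card : ℕ) : ℝ) ^ ((4 : ℝ) / 5))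

-- `AutomaticDesignBelowFourFifths` holds: proved by `Summit.MatrixMultiplication.MatrixMultiplication.Theorems.AutomaticDesignBelowFourFifths_proof` @ 08d8e8ffda1e (its module imports this route file, so no `_holds` link can be stated here).

/-- item stmt-MatrixMultiplication-7358 · crux · rank 3 · closed · proved by Summit.MatrixMultiplication.MatrixMultiplication.Theorems.RegularTowerGap.regularTowerGap_proof @ c3826934533d (prover) · by planner
why it might fail: May be false (one regular tower witnessing every eps gives omega = 2 outright); it holds for free if omega > 2 (CKSU 5.5, eps = omega - 2), so an unconditional proof is a genuine tameness theorem about matrix-cocycle pressures at P(2/3) = log p, with no tool in print.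
sources: CohnKleinbergSzegedyUmans2005, BlasiakChurchCohnGrochowNaslundSawinUmans2017, doi:10.1007/3-540-55808-x_48, doi:10.36045/bbms/1103408547, lean:Literature.Barriers.MatrixMultiplication.InfimumNotMinimumBarrier
[crux] (card T3, corrected to the per-automaton form; infimum-not-minimum along one regular tower)
for every base p >= 2 and every triple of regular languages whose family is STPP at all scales there
is eps > 0 such that eventually Sum_w (|A_w||B_w||C_w|)^((2+eps)/3) <= p^k: no single automaton
witnesses X_aut for every eps, so omega = 2 by this route needs a SEQUENCE of automata. Its negation
implies AutomaticPackingThesis, hence MatrixMultiplication, directly. [difficulty: L] -/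
@[route_item "route-MatrixMultiplication-AutomaticSTPPDesigns"]
def RegularTowerGap : Prop :=
  ∀ (p : ℕ) (ι : Type) [Fintype ι] (LA LB LC : Language (ι × Fin p)), 2 ≤ p → LA.IsRegular → LB.IsRegular → LC.IsRegular → let blk := fun (k : ℕ) (L : Language (ι × Fin p)) (w : Fin k → ι) => ((Finset.univ : Finset (Fin k → Fin p)).filter (fun a => List.ofFn (fun j : Fin k => (w j, a j)) ∈ L)).image (fun a : Fin k → Fin p => ((∑ j : Fin k, (a j : ℕ) * p ^ (j : ℕ) : ℕ) : ZMod (p ^ k))); (∀ k : ℕ, Literature.Combinatorics.Additive.AddSimultaneousTPP (blk k LA) (blk k LB) (blk k LC)) → ∃ ε : ℝ, 0 < ε ∧ ∃ k₀ : ℕ, ∀ k ≥ k₀, ∑ w : Fin k → ι, (((blk k LA w).card * (blk k LB w).card * (blk k LC w).card : ℕ) : ℝ) ^ ((2 + ε) / 3) ≤ (p : ℝ) ^ k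

-- `RegularTowerGap` holds: proved by `Summit.MatrixMultiplication.MatrixMultiplication.Theorems.RegularTowerGap.regularTowerGap_proof` @ c3826934533d (its module imports this route file, so no `_holds` link can be stated here).

/-- item stmt-MatrixMultiplication-7359 · crux · rank 4 · closed · proved by Summit.MatrixMultiplication.MatrixMultiplication.Theorems.singleAutomatonRigidity_proof @ b4aad75eafd0 (prover) · by planner
why it might fail: Weaker cousin of RegularTowerGap (implied by it plus triangle removal); may fail only via a tower meeting the packing bound within a constant (then omega = 2); unconditionally, removal lemmas cover bounded blocks and nothing controls growing blocks in Z_(p^k) (slice rank powerless, Thm B.8).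
sources: BlasiakChurchCohnGrochowNaslundSawinUmans2017, BlasiakChurchCohnGrochowUmans2017, CohnKleinbergSzegedyUmans2005, doi:10.1007/3-540-55808-x_48, lean:Literature.Combinatorics.Additive.AddSimultaneousTPP.sum_card_mul_card_le
[crux] (packing-bound form) for every base p >= 2 and every triple of regular languages whose family
is STPP at all scales, the packing functional at the critical exponent is o(p^k): for every c > 0,
eventually Sum_w (|A_w||B_w||C_w|)^(2/3) <= c p^k. By Hoelder over the three packing bounds the sum
is always <= p^k, so this says no regular tower stays within a constant of the packing bound
(BCCGNSU Def 2.3 / Lemma 2.4) along its scales. Its negation gives MatrixMultiplication (bounded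
blocks: triangle removal, in Mathlib; growing blocks: CKSU 5.5). [deps: RegularTowerGap]
[difficulty: L] -/
@[route_item "route-MatrixMultiplication-AutomaticSTPPDesigns"]
def SingleAutomatonRigidity : Prop :=
  ∀ (p : ℕ) (ι : Type) [Fintype ι] (LA LB LC : Language (ι × Fin p)), 2 ≤ p → LA.IsRegular → LB.IsRegular → LC.IsRegular → let blk := fun (k : ℕ) (L : Language (ι × Fin p)) (w : Fin k → ι) => ((Finset.univ : Finset (Fin k → Fin p)).filter (fun a => List.ofFn (fun j : Fin k => (w j, a j)) ∈ L)).image (fun a : Fin k → Fin p => ((∑ j : Fin k, (a j : ℕ) * p ^ (j : ℕ) : ℕ) : ZMod (p ^ k))); (∀ k : ℕ, Literature.Combinatorics.Additive.AddSimultaneousTPP (blk k LA) (blk k LB) (blk k LC)) → ∀ c : ℝ, 0 < c → ∃ k₀ : ℕ, ∀ k ≥ k₀, ∑ w : Fin k → ι, (((blk k LA w).card * (blk k LB w).card * (blk k LC w).card : ℕ) : ℝ) ^ ((2 : ℝ) / 3) ≤ c * (p : ℝ) ^ k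

-- `SingleAutomatonRigidity` holds: proved by `Summit.MatrixMultiplication.MatrixMultiplication.Theorems.singleAutomatonRigidity_proof` @ b4aad75eafd0 (its module imports this route file, so no `_holds` link can be stated here).

/-- item stmt-MatrixMultiplication-7360 · support · rank 9 · closed · proved by Summit.MatrixMultiplication.MatrixMultiplication.Theorems.smallScalesSuffice_proof (prover) · by planner
sources: doi:10.36045/bbms/1103408547, doi:10.1017/9781108775267, lean:DFA.pumping_lemma
[support] (card (D), the verification engine as a theorem) for DFAs M_A, M_B, M_C on state sets sA,
sB, sC reading iota x Fin p (p >= 2): if the induced family is STPP in Z_(p^k) for every k <= 14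
(|sA||sB||sC|)^2 then it is STPP at every scale. Proof route: violations of either clause of
AddSimultaneousTPP form a regular language (six membership runs, a carry in [-3,3], one inequality
flag: 14 (|sA||sB||sC|)^2 live states plus a sink), and Mathlib's DFA.pumping_lemma shortens any
longer violation. [difficulty: provable-now] -/
@[route_item "route-MatrixMultiplication-AutomaticSTPPDesigns"]
def SmallScalesSuffice : Prop :=
  ∀ (p : ℕ) (ι σA σB σC : Type) [Fintype σA] [Fintype σB] [Fintype σC] (MA : DFA (ι × Fin p) σA) (MB : DFA (ι × Fin p) σB) (MC : DFA (ι × Fin p) σC), 2 ≤ p → let blk := fun (k : ℕ) (L : Language (ι × Fin p)) (w : Fin k → ι) => ((Finset.univ : Finset (Fin k → Fin p)).filter (fun a => List.ofFn (fun j : Fin k => (w j, a j)) ∈ L)).image (fun a : Fin k → Fin p => ((∑ j : Fin k, (a j : ℕ) * p ^ (j : ℕ) : ℕ) : ZMod (p ^ k))); (∀ k ≤ 14 * (Fintype.card σA * Fintype.card σB * Fintype.card σC) ^ 2, Literature.Combinatorics.Additive.AddSimultaneousTPP (blk k MA.accepts) (blk k MB.accepts) (blk k MC.accepts)) → ∀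 k : ℕ, Literature.Combinatorics.Additive.AddSimultaneousTPP (blk k MA.accepts) (blk k MB.accepts) (blk k MC.accepts)

-- `SmallScalesSuffice` holds: proved by `Summit.MatrixMultiplication.MatrixMultiplication.Theorems.smallScalesSuffice_proof` (its module imports this route file, so no `_holds` link can be stated here).

/-- item stmt-MatrixMultiplication-7361 · support · rank 9 · closed · proved by Summit.MatrixMultiplication.MatrixMultiplication.Theorems.blockTensorTransfer_proof @ 63457b09b2f7 (prover) · by planner
sources: CohnKleinbergSzegedyUmans2005, lean:Literature.Combinatorics.Additive.AddSimultaneousTPP.prod, lean:Literature.Computability.AlgebraicComplexity.isSTPP_iff_addSimultaneousTPP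
[support] (planner's calibration lemma) every finite STPP design (A_i,B_i,C_i) in Z_N (IsSTPP, N >=
1) with Sum_i (|A_i||B_i||C_i|)^tau > 3pN yields, for that base p >= 2, three regular languages
whose all-scale family is STPP in every Z_(p^k) and beats p^k at exponent tau at infinitely many
scales: write representatives in [0,N) in base p inside blocks of K digits with p^K >= 3N-2 (so p^K
< 3pN) and concatenate m blocks (index words i_1 #^(K-1) i_2 ...; other lengths give empty blocks);
no carry crosses a block since |s'-s+t'-t+u'-u| <= 3(N-1) < p^K, so level Km is the m-fold product
design (CKSU Lemma 5.4, AddSimultaneousTPP.prod) with packing sum (Sum_i x_i^tau)^m > p^(Km).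
[difficulty: provable-now] -/
@[route_item "route-MatrixMultiplication-AutomaticSTPPDesigns"]
def BlockTensorTransfer : Prop :=
  ∀ (N n : ℕ) (A B C : Fin n → Finset (ZMod N)), 1 ≤ N → Literature.Computability.AlgebraicComplexity.IsSTPP A B C → ∀ p : ℕ, 2 ≤ p → ∀ τ : ℝ, 0 < τ → (3 * p * N : ℝ) < ∑ i, (((A i).card * (B i).card * (C i).card : ℕ) : ℝ) ^ τ → ∃ (ι : Type) (_ : Fintype ι) (LA LB LC : Language (ι × Fin p)), LA.IsRegular ∧ LB.IsRegular ∧ LC.IsRegular ∧ (let blk := fun (k : ℕ) (L : Language (ι × Fin p)) (w : Fin k → ι) => ((Finset.univ : Finset (Fin k → Fin p)).filter (fun a => List.ofFn (fun j : Fin k => (w j, a j)) ∈ L)).image (fun a : Fin k → Fin p => ((∑ j : Fin k, (a j : ℕ) * p ^ (j : ℕ) : ℕ) : ZMod (p ^ k))); (∀ k : ℕ, Literature.Combinatorics.Additive.AddSimultaneousTPP (blk k LA) (blk k LB) (blk k LC)) ∧ ∀ k₀ : ℕ, ∃ k ≥ k₀, (p : ℝ) ^ k < ∑ w : Fin k →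 ι, (((blk k LA w).card * (blk k LB w).card * (blk k LC w).card : ℕ) : ℝ) ^ τ)

-- `BlockTensorTransfer` holds: proved by `Summit.MatrixMultiplication.MatrixMultiplication.Theorems.blockTensorTransfer_proof` @ 63457b09b2f7 (its module imports this route file, so no `_holds` link can be stated here).

/-- item stmt-MatrixMultiplication-7362 · support · rank 9 · closed · proved by Summit.MatrixMultiplication.MatrixMultiplication.Theorems.NontrivialAllScalesFamily_proof @ acdfbfd15783 (prover) · by planner
sources: CohnKleinbergSzegedyUmans2005, lean:Literature.Combinatorics.Additive.AddSimultaneousTPP.prod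
[support] (first rung, provable now) there exist a base p >= 2 and three regular languages whose
all-scale family is STPP in every Z_(p^k) with solution mass exceeding the host, p^k < Sum_w
|A_w||B_w||C_w|, at infinitely many scales (tau = 1: a machine-checkable regular tower certifying
some omega < 3). Recipe: CKSU Prop 5.2 in Z_(n1) x Z_(n2) x Z_(n3) = Z_(n1 n2 n3) (CRT, pairwise
coprime n_i >= 100) has mass 2 (n1-1)(n2-1)(n3-1); its cube over 9 pairwise coprime moduli (CKSU
Lemma 5.4) is a design in a cyclic Z_N with mass > 7N > 3pN for p = 2; apply BlockTensorTransfer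
with tau = 1. [difficulty: provable-now] -/
@[route_item "route-MatrixMultiplication-AutomaticSTPPDesigns"]
def NontrivialAllScalesFamily : Prop :=
  ∃ (p : ℕ) (ι : Type) (_ : Fintype ι) (LA LB LC : Language (ι × Fin p)), 2 ≤ p ∧ LA.IsRegular ∧ LB.IsRegular ∧ LC.IsRegular ∧ (let blk := fun (k : ℕ) (L : Language (ι × Fin p)) (w : Fin k → ι) => ((Finset.univ : Finset (Fin k → Fin p)).filter (fun a => List.ofFn (fun j : Fin k => (w j, a j)) ∈ L)).image (fun a : Fin k → Fin p => ((∑ j : Fin k, (a j : ℕ) * p ^ (j : ℕ) : ℕ) : ZMod (p ^ k))); (∀ k : ℕ, Literature.Combinatorics.Additive.AddSimultaneousTPP (blk k LA) (blk k LB) (blk k LC)) ∧ ∀ k₀ : ℕ, ∃ k ≥ k₀, p ^ k < ∑ w : Fin k → ι, (blk k LA w).card * (blk k LB w).card * (blk k LC w).card)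

-- `NontrivialAllScalesFamily` holds: proved by `Summit.MatrixMultiplication.MatrixMultiplication.Theorems.NontrivialAllScalesFamily_proof` @ acdfbfd15783 (its module imports this route file, so no `_holds` link can be stated here).

/-- item stmt-MatrixMultiplication-7363 · assembly · rank 1 · closed · proved by Summit.MatrixMultiplication.MatrixMultiplication.Theorems.automaticSTPPDesigns_assembly_proof (prover) · by planner
sources: CohnKleinbergSzegedyUmans2005, lean:Literature.Computability.AlgebraicComplexity.CohnKleinbergSzegedyUmans2005_5_5_abelian_holds, lean:MatrixMultiplication.GroupTheoreticSTPP.matrixMultiplication_of_cksu_of_thesis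
[assembly] AutomaticPackingThesis -> MatrixMultiplication (omega(C) = 2). -/
@[route_item "route-MatrixMultiplication-AutomaticSTPPDesigns"]
def Assembly : Prop :=
  AutomaticPackingThesis → MatrixMultiplication

-- `Assembly` holds: proved by `Summit.MatrixMultiplication.MatrixMultiplication.Theorems.automaticSTPPDesigns_assembly_proof` (its module imports this route file, so no `_holds` link can be stated here).

/-! D-0027 §2.1 — DECIDING THEOREM (planner-authored via `route open/edit --closes-file`; by planner-rbadge-MatrixMultiplication-AutomaticS-0b2cb0ac-g2-0 2026-08-15T16:14:46Z):
its hypotheses are this route's items and its conclusion the sub-problem Statement (glue_lint), and it elaborates with this file. -/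

@[closes "route-MatrixMultiplication-AutomaticSTPPDesigns"] theorem closes (h : AutomaticPackingThesis) : MatrixMultiplication := by
  classical
  -- CKSU 2005 Thm 5.5 (abelian, proved in tree) for a family indexed by an arbitrary `Fintype`,
  -- reindexed along `Fintype.equivFin`.
  have key : ∀ (J : Type) [Fintype J] (H : Type) [AddCommGroup H] [Fintype H]
      (A B C : J → Finset H), Literature.Combinatorics.Additive.AddSimultaneousTPP A B C →
      ∑ w, (((A w).card * (B w).card * (C w).card : ℕ) : ℝ) ^
          (Literature.Computability.AlgebraicComplexity.omega ℂ / 3) ≤ (Fintype.card H : ℝ) := by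
    intro J _ H _ _ A B C hS
    set e : Fin (Fintype.card J) ≃ J := (Fintype.equivFin J).symm with he
    have hS' : Literature.Computability.AlgebraicComplexity.IsSTPP (A ∘ e) (B ∘ e) (C ∘ e) := by
      rw [Literature.Combinatorics.Additive.addSimultaneousTPP_iff_forall] at hS
      intro i j l s hs s' hs' t ht t' ht' u hu u' hu' h0
      obtain ⟨hij, hjl, rest⟩ := hS (e i) (e j) (e l) s hs s' hs' t ht t' ht' u hu u' hu' h0
      exact ⟨e.injective hij, e.injective hjl, rest⟩
    have hle := Literature.Computability.AlgebraicComplexity.CohnKleinbergSzegedyUmans2005_5_5_abelian_holds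
      H (Fintype.card J) (A ∘ e) (B ∘ e) (C ∘ e) hS'
    calc ∑ w, (((A w).card * (B w).card * (C w).card : ℕ) : ℝ) ^
          (Literature.Computability.AlgebraicComplexity.omega ℂ / 3)
        = ∑ i, ((((A ∘ e) i).card * ((B ∘ e) i).card * ((C ∘ e) i).card : ℕ) : ℝ) ^
          (Literature.Computability.AlgebraicComplexity.omega ℂ / 3) :=
          (e.sum_comp (fun w => (((A w).card * (B w).card * (C w).card : ℕ) : ℝ) ^
            (Literature.Computability.AlgebraicComplexity.omega ℂ / 3))).symm
      _ ≤ (Fintype.card H : ℝ) := hle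
  rw [MatrixMultiplication_iff]
  refine le_antisymm ?_ (Literature.Computability.AlgebraicComplexity.omega_two_le ℂ)
  refine not_lt.1 fun hlt => ?_
  obtain ⟨p, hp, h⟩ := h
  obtain ⟨ι, _, LA, LB, LC, -, -, -, hS, hbeat⟩ :=
    h (Literature.Computability.AlgebraicComplexity.omega ℂ - 2) (sub_pos.2 hlt)
  obtain ⟨k, -, hk⟩ := hbeat 0
  have hexp : (2 + (Literature.Computability.AlgebraicComplexity.omega ℂ - 2)) / 3 =
      Literature.Computability.AlgebraicComplexity.omega ℂ / 3 := by ring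
  rw [hexp] at hk
  haveI : NeZero (p ^ k) := ⟨pow_ne_zero _ (by omega)⟩
  have hle := key (Fin k → ι) (ZMod (p ^ k)) _ _ _ (hS k)
  rw [ZMod.card, Nat.cast_pow] at hle
  exact absurd (hk.trans_le hle) (lt_irrefl _)

end Summit.MatrixMultiplication.MatrixMultiplication.Theses.AutomaticSTPPDesigns
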